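import Literature.NumberTheory.Automorphic.HeckeTraceFormulaGL2Level
import Mathlib.NumberTheory.ArithmeticFunction.Misc
import HarnessLib

/-!
# The Eichler–Selberg geometric side at the levels `M p` and `M` (`p ∤ M` prime, weight `2`,
# trivial character): `A(Mp) - 2 A(M)`, the `GL₂` side of Eichler's trace identity

[Proofs] Theorems only (D-0026), about the vendored geometric side `geometricSide N χ k n =
A₁ + A₂ + A₃ + A₄` of the named fact `HeckeTraceFormulaGL2Level` (`HeckeTraceFormulaGL2Level.lean`;
R. Schoof, M. van der Vlugt, JCTA **57** (1991), Thm. 2.2 = Cohen–Oesterlé's form of the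
Eichler–Selberg trace formula). For `χ = 𝟙`, `k = 2`, a prime `p ∤ M` and `(n, Mp) = 1` the four
terms are evaluated / compared between the levels `Mp` and `M`:

* `parabolicTerm_one_two_of_coprime`: `A₄ = σ₁(n)`;
* `identityTerm_one_two_of_coprime`: `A₁ = δ(n = □) ψ(N)/12`, and `ψ(Mp) = (p + 1) ψ(M)`
  (`dedekindPsi_mul_prime`);
* `hyperbolicTerm_one_two_of_coprime`, `hyperbolicTerm_one_two_mul_prime`: `χ(y) = 1` and
  `A₃(Mp) = 2 A₃(M)` (the divisors `c`, `cp` of `Mp`, `c ∣ M`, have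
  `gcd(c, Mp/c) = gcd(cp, M/c) = gcd(c, M/c)`);
* `localDensity_one_mul`: **multiplicativity of the local densities in the level**,
  `μ_{Mp}(t, f, n) = μ_M(t, f, n) μ_p(t, f, n)` for coprime `M, p` and `f² ∣ t² - 4n` (Chinese
  remainder theorem; the solutions of `x² - tx + n ≡ 0 (mod N N_f)` only depend on `x (mod N)`,
  `dvd_quadratic_of_dvd_sub` — "it is left to the reader to verify that the `x`'s occurring in the
  sum are well defined", loc. cit.);

whence the main identity `geometricSide_one_two_mul_prime_sub`:

  `A(Mp)(n) - 2 A(M)(n) = δ(n = □)(p - 1)ψ(M)/12 - σ₁(n)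
      - ½ Σ_{t² < 4n} Σ_f h_w((t² - 4n)/f²) μ_M(t, f, n) (μ_p(t, f, n) - 2)`,

and, granting the trace formula at both levels, the same for
`Tr(T_n | S₂(Γ₀(Mp))) - 2 Tr(T_n | S₂(Γ₀(M)))` — the trace of `T_n` on the `p`-new subspace
(`cuspidalHeckeTrace_mul_prime_sub_of_traceFormula`). Here `μ_p(t, f, n) - 2 = (d/p) - 1`
(`d = t² - 4n`) for `p ∤ f` and `= p - 1` for `p ∣ f`.

Use: this is the `GL₂` half of Eichler's trace identity
`tr_{Mp} T(n) - 2 tr_M T(n) = tr B(n; p, M) - σ₁(n)` between Hecke operators and the Brandt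
matrices of an Eichler order of level `M` in the definite quaternion algebra of discriminant `p`
(Eichler 1955 (5); Pizer, J. Algebra 64 (1980), Thm. 2.25 (2.8), `r = 0`, `k = 2`), from which the
tree proves Eichler's basis theorem in Hecke-module form and multiplicity one for Brandt
eigen-lattices (`EichlerBasisTheoremOfTraceIdentity.lean`); the quaternion half is Eichler's trace
formula for Brandt matrices (Vignéras, LNM 800, Ch. V Prop. 2.4) — see
`EichlerBasisTheoremOfTraceFormulas.lean`.

## References

* [SchoofVandervlugt1991] R. Schoof, M. van der Vlugt, JCTA 57 (1991) 163–186, Thm. 2.2, p. 168.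
* [Pizer1980] A. Pizer, J. Algebra 64 (1980) 340–390, Thm. 2.25 (2.8), Remark 2.26.
* M. Eichler, J. reine angew. Math. 195 (1955) 127–151, (5).
-/

noncomputable section

open scoped ArithmeticFunction.sigma
open ArithmeticFunction

namespace Literature.NumberTheory.Automorphic.HeckeTraceFormulaGL2Level

/-! ### Parabolic and identity terms for `(n, N) = 1`, `k = 2`, `χ = 𝟙` -/

/-- **Parabolic term for `(n, N) = 1`, `k = 2`, trivial character:** `A₄ = σ₁(n)` (every
`t ∣ n` has `gcd(N, n/t) = 1`). [cite: SchoofVandervlugt1991, Thm. 2.2 (A₄), p. 168] -/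
theorem parabolicTerm_one_two_of_coprime {N n : ℕ} (hn : n.Coprime N) :
    parabolicTerm N 1 2 n = ((σ 1 n : ℕ) : ℂ) := by
  classical
  unfold parabolicTerm
  rw [if_pos ⟨rfl, rfl⟩, Finset.filter_true_of_mem fun t ht ↦ ?_]
  · rw [sigma_one_apply, Nat.cast_sum]
  · exact (Nat.Coprime.coprime_dvd_left (Nat.div_dvd_of_dvd (Nat.dvd_of_mem_divisors ht)) hn).symm

/-- **Identity term for `(n, N) = 1`, `k = 2`, trivial character:** `A₁ = ψ(N)/12` if `n` is a
square (`χ(√n) = 1` as `√n` is prime to `N`), `0` otherwise. [cite: SchoofVandervlugt1991, Thm. 2.2 (A₁), p. 168] -/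
theorem identityTerm_one_two_of_coprime {N n : ℕ} (hn : n.Coprime N) :
    identityTerm N 1 2 n = if IsSquare n then (dedekindPsi N : ℂ) / 12 else 0 := by
  unfold identityTerm
  split_ifs with hsq
  · obtain ⟨s, rfl⟩ := hsq
    have hs : Nat.sqrt (s * s) = s := Nat.sqrt_eq s
    have hunit : IsUnit (s : ZMod N) :=
      (ZMod.isUnit_iff_coprime s N).2 (Nat.Coprime.coprime_mul_left hn)
    rw [hs, MulChar.one_apply hunit]
    norm_num
    ring
  · rfl

/-- `ψ(M p) = (p + 1) ψ(M)` for a prime `p ∤ M`. [folklore] -/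
theorem dedekindPsi_mul_prime {M p : ℕ} (hM : M ≠ 0) (hp : p.Prime) (hpM : ¬ p ∣ M) :
    dedekindPsi (M * p) = dedekindPsi M * (p + 1) := by
  unfold dedekindPsi
  have hpf : (M * p).primeFactors = insert p M.primeFactors := by
    rw [Nat.primeFactors_mul hM hp.ne_zero, hp.primeFactors, Finset.union_comm]
    rfl
  have hnot : p ∉ M.primeFactors := fun h ↦ hpM (Nat.dvd_of_mem_primeFactors h)
  rw [hpf, Finset.prod_insert hnot]
  have hp0 : (p : ℚ) ≠ 0 := by exact_mod_cast hp.ne_zero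
  push_cast
  field_simp

/-! ### Hyperbolic term for `(n, N) = 1`, `k = 2`, `χ = 𝟙` -/

/-- `χ(y) = 1` for the number `y` of the hyperbolic term, trivial character: if `y ≡ a (mod c)`,
`y ≡ b (mod e)` with `a`, `b` prime to `N = c e`, then `y` is a unit modulo `N`.
[cite: SchoofVandervlugt1991, Thm. 2.2 (A₃), p. 168] -/
theorem crtCharValue_one_eq_one {N c e a b : ℕ} (hce : c * e = N) (ha : a.Coprime N)
    (hb : b.Coprime N) (hsol : ∃ y : ℕ, (c : ℤ) ∣ (y : ℤ) - a ∧ (e : ℤ) ∣ (y : ℤ) - b) :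
    crtCharValue N 1 c e a b = 1 := by
  classical
  have hcop : ∀ (y d m : ℕ), d ∣ N → m.Coprime N → (d : ℤ) ∣ (y : ℤ) - m → Nat.Coprime y d := by
    intro y d m hd hm hdvd
    obtain ⟨q, hq⟩ := hdvd
    have hmd : IsCoprime (m : ℤ) (d : ℤ) :=
      Nat.isCoprime_iff_coprime.mpr (Nat.Coprime.coprime_dvd_right hd hm)
    have h : IsCoprime ((m : ℤ) + d * q) (d : ℤ) := hmd.add_mul_left_left q
    have hy : (y : ℤ) = m + d * q := by linear_combination hq
    rw [← hy] at h
    exact Nat.isCoprime_iff_coprime.mp h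
  have key : ∀ y : ℕ, (c : ℤ) ∣ (y : ℤ) - a → (e : ℤ) ∣ (y : ℤ) - b →
      (1 : DirichletCharacter ℂ N) (y : ZMod N) = 1 := by
    intro y hyc hye
    have hyN : Nat.Coprime y N := by
      rw [← hce]
      exact Nat.Coprime.mul_right (hcop y c a (Dvd.intro e hce) ha hyc)
        (hcop y e b (Dvd.intro_left c hce) hb hye)
    exact MulChar.one_apply ((ZMod.isUnit_iff_coprime y N).2 hyN)
  unfold crtCharValue
  rw [dif_pos hsol]
  have hs := Nat.find_spec hsol
  exact key _ hs.1 hs.2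

/-- **Hyperbolic term for `(n, N) = 1`, `k = 2`, trivial character:**
`A₃ = -Σ'_{d ∣ n, d ≤ √n} d · Σ_{c ∣ N, gcd(c, N/c) ∣ n/d - d} φ(gcd(c, N/c))` — the divisibility
`gcd(c, N/c) ∣ N/N_χ = N` is automatic and `χ(y) = 1`. [cite: SchoofVandervlugt1991, Thm. 2.2 (A₃), p. 168] -/
theorem hyperbolicTerm_one_two_of_coprime (N : ℕ) [NeZero N] {n : ℕ} (hn : n.Coprime N) :
    hyperbolicTerm N 1 2 n =
      -∑ d ∈ n.divisors.filter (fun d => d * d ≤ n),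
        (if d * d = n then (1 / 2 : ℂ) else 1) * (d : ℂ) *
          ∑ c ∈ N.divisors.filter (fun c => (Nat.gcd c (N / c) : ℤ) ∣ ((n / d : ℕ) : ℤ) - d),
            (Nat.totient (Nat.gcd c (N / c)) : ℂ) := by
  classical
  unfold hyperbolicTerm
  rw [DirichletCharacter.conductor_one, Nat.div_one]
  congr 1
  refine Finset.sum_congr rfl fun d hd ↦ ?_
  have hdn : d ∣ n := Nat.dvd_of_mem_divisors (Finset.mem_filter.1 hd).1
  rw [show ((2 : ℤ) - 1) = 1 by norm_num, zpow_one]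
  congr 1
  have hfilter : N.divisors.filter (fun c => Nat.gcd c (N / c) ∣ N ∧
        (Nat.gcd c (N / c) : ℤ) ∣ ((n / d : ℕ) : ℤ) - d) =
      N.divisors.filter (fun c => (Nat.gcd c (N / c) : ℤ) ∣ ((n / d : ℕ) : ℤ) - d) := by
    refine Finset.filter_congr fun c hc ↦ ?_
    exact ⟨fun h ↦ h.2, fun h ↦ ⟨(Nat.gcd_dvd_left _ _).trans (Nat.dvd_of_mem_divisors hc), h⟩⟩
  rw [hfilter]
  refine Finset.sum_congr rfl fun c hc ↦ ?_
  obtain ⟨hc, hgcd⟩ := Finset.mem_filter.1 hc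
  have hcN : c ∣ N := Nat.dvd_of_mem_divisors hc
  rw [crtCharValue_one_eq_one (Nat.mul_div_cancel' hcN) (Nat.Coprime.coprime_dvd_left hdn hn)
    (Nat.Coprime.coprime_dvd_left (Nat.div_dvd_of_dvd hdn) hn) ?_, mul_one]
  obtain ⟨y, hy₁, hy₂⟩ := Nat.chineseRemainder' (Nat.modEq_iff_dvd.mpr hgcd)
  exact ⟨y, Nat.modEq_iff_dvd.mp hy₁.symm, Nat.modEq_iff_dvd.mp hy₂.symm⟩

/-- The divisors of `M p`, `p` a prime not dividing `M`, are the `c` and the `c p`, `c ∣ M`. [folklore] -/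
theorem sum_divisors_mul_prime_eq_add {β : Type*} [AddCommMonoid β] {M p : ℕ} (hM : M ≠ 0) (hp : p.Prime)
    (hpM : ¬ p ∣ M) (g : ℕ → β) :
    ∑ c ∈ (M * p).divisors, g c = ∑ c ∈ M.divisors, g c + ∑ c ∈ M.divisors, g (c * p) := by
  classical
  have hdisj : Disjoint M.divisors (M.divisors.image (· * p)) := by
    rw [Finset.disjoint_left]
    intro c hc hc'
    obtain ⟨c', -, rfl⟩ := Finset.mem_image.1 hc'
    exact hpM ((Dvd.intro_left c' rfl).trans (Nat.dvd_of_mem_divisors hc))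
  have hunion : (M * p).divisors = M.divisors ∪ M.divisors.image (· * p) := by
    ext c
    simp only [Finset.mem_union, Finset.mem_image, Nat.mem_divisors]
    constructor
    · rintro ⟨hc, -⟩
      by_cases hpc : p ∣ c
      · obtain ⟨c', rfl⟩ := hpc
        refine Or.inr ⟨c', ⟨?_, hM⟩, by ring⟩
        rw [mul_comm M p] at hc
        exact Nat.dvd_of_mul_dvd_mul_left hp.pos hc
      · exact Or.inl ⟨Nat.Coprime.dvd_of_dvd_mul_right
          (Nat.coprime_comm.mp ((Nat.Prime.coprime_iff_not_dvd hp).2 hpc)) hc, hM⟩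
    · rintro (⟨hc, -⟩ | ⟨c', ⟨hc', -⟩, rfl⟩)
      · exact ⟨hc.trans (Dvd.intro p rfl), mul_ne_zero hM hp.ne_zero⟩
      · exact ⟨Nat.mul_dvd_mul_right hc' p, mul_ne_zero hM hp.ne_zero⟩
  rw [hunion, Finset.sum_union hdisj, Finset.sum_image]
  intro x _ y _ h
  exact Nat.eq_of_mul_eq_mul_right hp.pos h

/-- The cusp-type sums `Σ_{c ∣ N, gcd(c, N/c) ∣ m} φ(gcd(c, N/c))` double from level `M` to level
`M p` (`p` prime, `p ∤ M`): the divisors `c`, `c p` of `M p` have `gcd(c, Mp/c) = gcd(cp, M/c) =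
gcd(c, M/c)`. [folklore] -/
theorem sum_totient_gcd_mul_prime {M p : ℕ} (hM : M ≠ 0) (hp : p.Prime) (hpM : ¬ p ∣ M) (m : ℤ) :
    ∑ c ∈ (M * p).divisors.filter (fun c => (Nat.gcd c (M * p / c) : ℤ) ∣ m),
        (Nat.totient (Nat.gcd c (M * p / c)) : ℂ) =
      2 * ∑ c ∈ M.divisors.filter (fun c => (Nat.gcd c (M / c) : ℤ) ∣ m),
        (Nat.totient (Nat.gcd c (M / c)) : ℂ) := by
  classical
  rw [Finset.sum_filter, Finset.sum_filter, sum_divisors_mul_prime_eq_add hM hp hpM, two_mul]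
  congr 1
  · refine Finset.sum_congr rfl fun c hc ↦ ?_
    have hcM : c ∣ M := Nat.dvd_of_mem_divisors hc
    have hcp : Nat.Coprime p c :=
      (Nat.Prime.coprime_iff_not_dvd hp).2 fun h ↦ hpM (h.trans hcM)
    rw [Nat.mul_div_right_comm hcM, Nat.Coprime.gcd_mul_right_cancel_right _ hcp]
  · refine Finset.sum_congr rfl fun c hc ↦ ?_
    have hcM : c ∣ M := Nat.dvd_of_mem_divisors hc
    have hcp : Nat.Coprime p (M / c) :=
      (Nat.Prime.coprime_iff_not_dvd hp).2 fun h ↦ hpM (h.trans (Nat.div_dvd_of_dvd hcM))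
    rw [Nat.mul_div_mul_right _ _ hp.pos, Nat.Coprime.gcd_mul_right_cancel _ hcp]

/-- **`A₃(Mp) = 2 A₃(M)`** for `p` prime, `p ∤ M`, `(n, Mp) = 1`, weight `2`, trivial character.
[cite: SchoofVandervlugt1991, Thm. 2.2 (A₃), p. 168] -/
theorem hyperbolicTerm_one_two_mul_prime {M p n : ℕ} [NeZero M] (hp : p.Prime) (hpM : ¬ p ∣ M)
    (hn : n.Coprime (M * p)) :
    hyperbolicTerm (M * p) 1 2 n = 2 * hyperbolicTerm M 1 2 n := by
  classical
  have hM : M ≠ 0 := NeZero.ne M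
  haveI : NeZero (M * p) := ⟨mul_ne_zero hM hp.ne_zero⟩
  have hnM : n.Coprime M := Nat.Coprime.coprime_dvd_right (Dvd.intro p rfl) hn
  rw [hyperbolicTerm_one_two_of_coprime (M * p) hn, hyperbolicTerm_one_two_of_coprime M hnM,
    mul_neg, Finset.mul_sum]
  congr 1
  refine Finset.sum_congr rfl fun d _ ↦ ?_
  rw [sum_totient_gcd_mul_prime hM hp hpM]
  ring

/-! ### Local densities for the trivial character: multiplicativity in the level -/

/-- `ψ` is multiplicative on coprime arguments. [folklore] -/
theorem dedekindPsi_mul_of_coprime {a b : ℕ} (ha : a ≠ 0) (hb : b ≠ 0) (hab : a.Coprime b) :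
    dedekindPsi (a * b) = dedekindPsi a * dedekindPsi b := by
  unfold dedekindPsi
  rw [Nat.primeFactors_mul ha hb, Finset.prod_union hab.disjoint_primeFactors]
  push_cast
  ring

/-- `ψ(N) > 0` for `N ≥ 1`. [folklore] -/
theorem dedekindPsi_pos {N : ℕ} (hN : N ≠ 0) : 0 < dedekindPsi N := by
  unfold dedekindPsi
  refine mul_pos (by exact_mod_cast Nat.pos_of_ne_zero hN) (Finset.prod_pos fun p _ ↦ ?_)
  positivity

/-- "The `x` occurring in the sum are well defined" (loc. cit.): for `f² ∣ t² - 4n`, `g ∣ f`,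
`g ∣ N`, the condition `N g ∣ x² - t x + n` depends only on `x (mod N)` (a solution has
`g ∣ 2x - t`). [cite: SchoofVandervlugt1991, Thm. 2.2 (definition of μ(t, f, n)), p. 168] -/
theorem dvd_quadratic_of_dvd_sub {N g : ℕ} {t : ℤ} {f n : ℕ} (hgN : g ∣ N) (hgf : g ∣ f)
    (hf : (f : ℤ) ^ 2 ∣ t ^ 2 - 4 * n) {x y : ℤ} (hxy : (N : ℤ) ∣ y - x)
    (hx : ((N * g : ℕ) : ℤ) ∣ x ^ 2 - t * x + n) : ((N * g : ℕ) : ℤ) ∣ y ^ 2 - t * y + n := by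
  obtain ⟨m, hm⟩ := hxy
  have hg2 : (g : ℤ) ∣ 2 * x - t := by
    have h1 : (g : ℤ) ^ 2 ∣ (2 * x - t) ^ 2 := by
      have e : (2 * x - t) ^ 2 = 4 * (x ^ 2 - t * x + n) + (t ^ 2 - 4 * n) := by ring
      rw [e]
      refine dvd_add (Dvd.dvd.mul_left ?_ 4) ?_
      · refine dvd_trans ?_ hx
        obtain ⟨k, hk⟩ := hgN
        exact ⟨k, by rw [hk]; push_cast; ring⟩
      · refine dvd_trans ?_ hf
        obtain ⟨k, hk⟩ := hgf
        exact ⟨(k : ℤ) ^ 2, by rw [hk]; push_cast; ring⟩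
    exact (Int.pow_dvd_pow_iff two_ne_zero).mp h1
  have e : y ^ 2 - t * y + n = (x ^ 2 - t * x + n) + (N : ℤ) * m * ((N : ℤ) * m + (2 * x - t)) := by
    rw [show y = x + N * m by linear_combination hm]
    ring
  rw [e]
  refine dvd_add hx ?_
  push_cast
  exact mul_dvd_mul (dvd_mul_right _ _)
    (dvd_add ((Int.natCast_dvd_natCast.mpr hgN).mul_right _) hg2)

/-- For the trivial character the local density is `ψ(N)/ψ(N/N_f)` times the number of units
`x ∈ (ℤ/Nℤ)ˣ` with `N N_f ∣ x² - t x + n` (`x` read in `[0, N)`).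
[cite: SchoofVandervlugt1991, Thm. 2.2 (definition of μ(t, f, n)), p. 168] -/
theorem localDensity_one_eq_card (N : ℕ) [NeZero N] (t : ℤ) (f n : ℕ) :
    localDensity N 1 t f n = ((dedekindPsi N / dedekindPsi (N / Nat.gcd N f) : ℚ) : ℂ) *
      ((Finset.univ.filter fun x : ZMod N =>
          ((N * Nat.gcd N f : ℕ) : ℤ) ∣ (x.val : ℤ) ^ 2 - t * x.val + n ∧ IsUnit x).card : ℂ) := by
  classical
  unfold localDensity
  congr 1
  have hsum : (∑ x ∈ Finset.range N,
      if ((N * Nat.gcd N f : ℕ) : ℤ) ∣ (x : ℤ) ^ 2 - t * x + n then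
        (1 : DirichletCharacter ℂ N) (x : ZMod N) else 0) =
      ∑ x ∈ Finset.range N,
        if ((N * Nat.gcd N f : ℕ) : ℤ) ∣ (x : ℤ) ^ 2 - t * x + n ∧ IsUnit (x : ZMod N)
        then (1 : ℂ) else 0 := by
    refine Finset.sum_congr rfl fun x _ ↦ ?_
    by_cases hD : ((N * Nat.gcd N f : ℕ) : ℤ) ∣ (x : ℤ) ^ 2 - t * x + n
    · by_cases hu : IsUnit (x : ZMod N)
      · rw [if_pos hD, if_pos ⟨hD, hu⟩, MulChar.one_apply hu]
      · rw [if_pos hD, if_neg (fun h ↦ hu h.2), MulChar.map_nonunit _ hu]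
    · rw [if_neg hD, if_neg (fun h ↦ hD h.1)]
  rw [hsum, Finset.sum_boole]
  congr 1
  refine Finset.card_bij (fun x _ ↦ (x : ZMod N)) (fun x hx ↦ ?_) (fun x₁ hx₁ x₂ hx₂ h ↦ ?_)
    (fun y hy ↦ ?_)
  · obtain ⟨hx, hD, hu⟩ := Finset.mem_filter.1 hx
    refine Finset.mem_filter.2 ⟨Finset.mem_univ _, ?_, hu⟩
    rwa [ZMod.val_cast_of_lt (Finset.mem_range.1 hx)]
  · have h₁ := (Finset.mem_filter.1 hx₁).1
    have h₂ := (Finset.mem_filter.1 hx₂).1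
    rw [Finset.mem_range] at h₁ h₂
    have := congrArg ZMod.val h
    rwa [ZMod.val_cast_of_lt h₁, ZMod.val_cast_of_lt h₂] at this
  · obtain ⟨-, hD, hu⟩ := Finset.mem_filter.1 hy
    refine ⟨y.val, Finset.mem_filter.2 ⟨Finset.mem_range.2 (ZMod.val_lt y), hD, ?_⟩,
      ZMod.natCast_zmod_val y⟩
    rwa [ZMod.natCast_zmod_val]

/-- The unit count of `localDensity_one_eq_card` only depends on residues: reduction of the
representative modulo `N`. [cite: SchoofVandervlugt1991, Thm. 2.2 (definition of μ(t, f, n)), p. 168] -/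
theorem dvd_quadratic_iff_of_cast_eq {N L : ℕ} [NeZero N] [NeZero L] {t : ℤ} {f n : ℕ}
    (hf : (f : ℤ) ^ 2 ∣ t ^ 2 - 4 * n) (x : ZMod L) :
    ((N * Nat.gcd N f : ℕ) : ℤ) ∣ (x.val : ℤ) ^ 2 - t * x.val + n ↔
      ((N * Nat.gcd N f : ℕ) : ℤ) ∣ ((ZMod.cast x : ZMod N).val : ℤ) ^ 2 -
        t * (ZMod.cast x : ZMod N).val + n := by
  have hval : (ZMod.cast x : ZMod N).val = x.val % N := by
    rw [ZMod.cast_eq_val, ZMod.val_natCast]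
  have hdiff : (N : ℤ) ∣ ((x.val % N : ℕ) : ℤ) - (x.val : ℤ) := by
    have h := Nat.mod_add_div x.val N
    refine ⟨-((x.val / N : ℕ) : ℤ), ?_⟩
    have h' : ((x.val % N : ℕ) : ℤ) + (N : ℤ) * ((x.val / N : ℕ) : ℤ) = (x.val : ℤ) := by
      exact_mod_cast h
    linear_combination h'
  rw [hval]
  exact ⟨fun h ↦ dvd_quadratic_of_dvd_sub (Nat.gcd_dvd_left N f) (Nat.gcd_dvd_right N f) hf hdiff h,
    fun h ↦ dvd_quadratic_of_dvd_sub (Nat.gcd_dvd_left N f) (Nat.gcd_dvd_right N f) hf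
      (dvd_sub_comm.mp hdiff) h⟩

/-- **Multiplicativity of the local densities in the level** (trivial character): for coprime
levels `M`, `p` and a conductor `f` with `f² ∣ t² - 4n`,
`μ_{Mp}(t, f, n) = μ_M(t, f, n) · μ_p(t, f, n)` — `ψ` and `N ↦ N_f = gcd(N, f)` are
multiplicative and the unit solutions of `x² - t x + n ≡ 0 (mod N N_f)` split by the Chinese
remainder theorem. [cite: SchoofVandervlugt1991, Thm. 2.2 (definition of μ(t, f, n)), p. 168] -/
theorem localDensity_one_mul {M p : ℕ} [NeZero M] [NeZero p] (hMp : M.Coprime p) {t : ℤ}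
    {f n : ℕ} (hf : (f : ℤ) ^ 2 ∣ t ^ 2 - 4 * n) :
    localDensity (M * p) 1 t f n = localDensity M 1 t f n * localDensity p 1 t f n := by
  classical
  have hM : M ≠ 0 := NeZero.ne M
  have hp : p ≠ 0 := NeZero.ne p
  haveI : NeZero (M * p) := ⟨mul_ne_zero hM hp⟩
  rw [localDensity_one_eq_card, localDensity_one_eq_card, localDensity_one_eq_card]
  have hgMd : Nat.gcd M f ∣ M := Nat.gcd_dvd_left M f
  have hgpd : Nat.gcd p f ∣ p := Nat.gcd_dvd_left p f
  have hg : Nat.gcd (M * p) f = Nat.gcd M f * Nat.gcd p f := by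
    rw [Nat.gcd_comm, Nat.Coprime.gcd_mul f hMp, Nat.gcd_comm f M, Nat.gcd_comm f p]
  have hMg : M / Nat.gcd M f ≠ 0 := fun h ↦ hM (Nat.eq_zero_of_dvd_of_div_eq_zero hgMd h)
  have hpg : p / Nat.gcd p f ≠ 0 := fun h ↦ hp (Nat.eq_zero_of_dvd_of_div_eq_zero hgpd h)
  have hcop' : (M / Nat.gcd M f).Coprime (p / Nat.gcd p f) :=
    Nat.Coprime.coprime_dvd_left (Nat.div_dvd_of_dvd hgMd)
      (Nat.Coprime.coprime_dvd_right (Nat.div_dvd_of_dvd hgpd) hMp)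
  -- the prefactors
  have hψ : (dedekindPsi (M * p) / dedekindPsi (M * p / Nat.gcd (M * p) f) : ℚ) =
      dedekindPsi M / dedekindPsi (M / Nat.gcd M f) *
        (dedekindPsi p / dedekindPsi (p / Nat.gcd p f)) := by
    rw [hg, ← Nat.div_mul_div_comm hgMd hgpd, dedekindPsi_mul_of_coprime hM hp hMp,
      dedekindPsi_mul_of_coprime hMg hpg hcop', div_mul_div_comm]
  -- the unit solution counts
  have hcopZ : IsCoprime (((M * Nat.gcd M f : ℕ) : ℤ)) (((p * Nat.gcd p f : ℕ) : ℤ)) := by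
    refine Nat.isCoprime_iff_coprime.mpr (Nat.Coprime.mul_left ?_ ?_)
    · exact Nat.Coprime.mul_right hMp (Nat.Coprime.coprime_dvd_right hgpd hMp)
    · exact Nat.Coprime.mul_right (Nat.Coprime.coprime_dvd_left hgMd hMp)
        (Nat.Coprime.coprime_dvd_left hgMd (Nat.Coprime.coprime_dvd_right hgpd hMp))
  have hprod : (((M * p * Nat.gcd (M * p) f : ℕ) : ℤ)) =
      ((M * Nat.gcd M f : ℕ) : ℤ) * ((p * Nat.gcd p f : ℕ) : ℤ) := by
    rw [hg]; push_cast; ring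
  have hunit : ∀ x : ZMod (M * p),
      IsUnit x ↔ IsUnit (ZMod.cast x : ZMod M) ∧ IsUnit (ZMod.cast x : ZMod p) := by
    intro x
    rw [ZMod.cast_eq_val, ZMod.cast_eq_val, ZMod.isUnit_iff_coprime, ZMod.isUnit_iff_coprime,
      ← Nat.coprime_mul_iff_right, ← ZMod.isUnit_iff_coprime, ZMod.natCast_zmod_val]
  have hiff : ∀ x : ZMod (M * p),
      (((M * p * Nat.gcd (M * p) f : ℕ) : ℤ) ∣ (x.val : ℤ) ^ 2 - t * x.val + n ∧ IsUnit x) ↔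
        ((((M * Nat.gcd M f : ℕ) : ℤ) ∣ ((ZMod.cast x : ZMod M).val : ℤ) ^ 2 -
              t * (ZMod.cast x : ZMod M).val + n ∧ IsUnit (ZMod.cast x : ZMod M)) ∧
          (((p * Nat.gcd p f : ℕ) : ℤ) ∣ ((ZMod.cast x : ZMod p).val : ℤ) ^ 2 -
              t * (ZMod.cast x : ZMod p).val + n ∧ IsUnit (ZMod.cast x : ZMod p))) := by
    intro x
    rw [hprod, hunit x, ← dvd_quadratic_iff_of_cast_eq (N := M) hf x,
      ← dvd_quadratic_iff_of_cast_eq (N := p) hf x]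
    constructor
    · rintro ⟨h, hu₁, hu₂⟩
      exact ⟨⟨(dvd_mul_right _ _).trans h, hu₁⟩, ⟨(dvd_mul_left _ _).trans h, hu₂⟩⟩
    · rintro ⟨⟨h₁, hu₁⟩, ⟨h₂, hu₂⟩⟩
      exact ⟨hcopZ.mul_dvd h₁ h₂, hu₁, hu₂⟩
  have he : ∀ x : ZMod (M * p),
      ZMod.chineseRemainder hMp x = ((ZMod.cast x : ZMod M), (ZMod.cast x : ZMod p)) :=
    fun x ↦ Prod.ext (Prod.fst_zmod_cast x) (Prod.snd_zmod_cast x)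
  have hcount : (Finset.univ.filter fun x : ZMod (M * p) =>
        ((M * p * Nat.gcd (M * p) f : ℕ) : ℤ) ∣ (x.val : ℤ) ^ 2 - t * x.val + n ∧ IsUnit x).card =
      (Finset.univ.filter fun x : ZMod M =>
          ((M * Nat.gcd M f : ℕ) : ℤ) ∣ (x.val : ℤ) ^ 2 - t * x.val + n ∧ IsUnit x).card *
        (Finset.univ.filter fun x : ZMod p =>
          ((p * Nat.gcd p f : ℕ) : ℤ) ∣ (x.val : ℤ) ^ 2 - t * x.val + n ∧ IsUnit x).card := by
    rw [← Finset.card_product]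
    refine Finset.card_equiv (ZMod.chineseRemainder hMp).toEquiv fun x ↦ ?_
    simp only [Finset.mem_filter, Finset.mem_univ, true_and, Finset.mem_product,
      RingEquiv.toEquiv_eq_coe, EquivLike.coe_coe, he x]
    exact hiff x
  rw [hψ, hcount]
  push_cast
  ring

/-! ### The difference of the geometric sides at the levels `M p` and `M` -/

/-- The conductors `f` of the elliptic term have `f² ∣ t² - 4n`. [cite: SchoofVandervlugt1991, Thm. 2.2 (A₂), p. 168] -/
theorem sq_dvd_of_mem_ellipticConductors {t : ℤ} {n f : ℕ} (hf : f ∈ ellipticConductors t n) :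
    (f : ℤ) ^ 2 ∣ t ^ 2 - 4 * n :=
  (Finset.mem_filter.1 hf).2.1

/-- **`A(Mp) - 2 A(M)` for the geometric side `A = A₁ + A₂ + A₃ + A₄` of the Eichler–Selberg
trace formula in weight `2`, trivial character, `p` prime, `p ∤ M`, `(n, Mp) = 1`:**
`A(Mp)(n) - 2 A(M)(n) = δ(n = □) (p - 1) ψ(M)/12 - σ₁(n)
   - ½ Σ_{t² < 4n} Σ_f h_w((t² - 4n)/f²) μ_M(t, f, n) (μ_p(t, f, n) - 2)`
— the identity terms give `(ψ(Mp) - 2ψ(M))/12 = (p - 1) ψ(M)/12`, the hyperbolic terms cancel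
(`A₃(Mp) = 2 A₃(M)`), the parabolic terms give `σ₁(n) - 2σ₁(n)`, and in the elliptic terms
`μ_{Mp} = μ_M μ_p`. Granting the trace formula at both levels this is
`Tr(T_n | S₂(Γ₀(Mp))) - 2 Tr(T_n | S₂(Γ₀(M)))`, the trace of `T_n` on the `p`-new subspace
(`cuspidalHeckeTrace_mul_prime_sub_two_mul_of_traceFormula`); it is the `GL₂` side of Eichler's
trace identity `tr_{Mp} T(n) - 2 tr_M T(n) = tr B(n; p, M) - σ₁(n)` (Eichler 1955 (5); Pizer,
J. Algebra 64 (1980), Thm. 2.25 (2.8), `r = 0`, `k = 2`).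
[cite: SchoofVandervlugt1991, Thm. 2.2, p. 168] -/
theorem geometricSide_one_two_mul_prime_sub {M p n : ℕ} [NeZero M] (hp : p.Prime) (hpM : ¬ p ∣ M)
    (hn : n.Coprime (M * p)) :
    geometricSide (M * p) 1 2 n - 2 * geometricSide M 1 2 n =
      (if IsSquare n then ((p : ℂ) - 1) * (dedekindPsi M : ℂ) / 12 else 0) - ((σ 1 n : ℕ) : ℂ) -
        (1 / 2 : ℂ) *
          ∑ t ∈ (Finset.Icc (-(2 * n : ℤ)) (2 * n)).filter (fun t : ℤ => t ^ 2 < 4 * (n : ℤ)),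
            ∑ f ∈ ellipticConductors t n,
              (weightedClassNumber ((t ^ 2 - 4 * n) / (f : ℤ) ^ 2) : ℂ) *
                (localDensity M 1 t f n * (localDensity p 1 t f n - 2)) := by
  classical
  have hM : M ≠ 0 := NeZero.ne M
  haveI : NeZero p := ⟨hp.ne_zero⟩
  have hnM : n.Coprime M := Nat.Coprime.coprime_dvd_right (Dvd.intro p rfl) hn
  have hMp : M.Coprime p := Nat.coprime_comm.mp ((Nat.Prime.coprime_iff_not_dvd hp).2 hpM)
  unfold geometricSide
  rw [identityTerm_one_two_of_coprime hn, identityTerm_one_two_of_coprime hnM,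
    parabolicTerm_one_two_of_coprime hn, parabolicTerm_one_two_of_coprime hnM,
    hyperbolicTerm_one_two_mul_prime hp hpM hn, dedekindPsi_mul_prime hM hp hpM]
  unfold ellipticTerm
  have hA : (∑ t ∈ (Finset.Icc (-(2 * n : ℤ)) (2 * n)).filter (fun t : ℤ => t ^ 2 < 4 * (n : ℤ)),
      archFactor 2 t n * ∑ f ∈ ellipticConductors t n,
        (weightedClassNumber ((t ^ 2 - 4 * n) / (f : ℤ) ^ 2) : ℂ) * localDensity (M * p) 1 t f n) =
      ∑ t ∈ (Finset.Icc (-(2 * n : ℤ)) (2 * n)).filter (fun t : ℤ => t ^ 2 < 4 * (n : ℤ)),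
        ∑ f ∈ ellipticConductors t n,
          (weightedClassNumber ((t ^ 2 - 4 * n) / (f : ℤ) ^ 2) : ℂ) * localDensity M 1 t f n *
            localDensity p 1 t f n := by
    refine Finset.sum_congr rfl fun t ht ↦ ?_
    rw [archFactor_two (Finset.mem_filter.1 ht).2, one_mul]
    refine Finset.sum_congr rfl fun f hf ↦ ?_
    rw [localDensity_one_mul hMp (sq_dvd_of_mem_ellipticConductors hf), mul_assoc]
  have hB : (∑ t ∈ (Finset.Icc (-(2 * n : ℤ)) (2 * n)).filter (fun t : ℤ => t ^ 2 < 4 * (n : ℤ)),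
      archFactor 2 t n * ∑ f ∈ ellipticConductors t n,
        (weightedClassNumber ((t ^ 2 - 4 * n) / (f : ℤ) ^ 2) : ℂ) * localDensity M 1 t f n) =
      ∑ t ∈ (Finset.Icc (-(2 * n : ℤ)) (2 * n)).filter (fun t : ℤ => t ^ 2 < 4 * (n : ℤ)),
        ∑ f ∈ ellipticConductors t n,
          (weightedClassNumber ((t ^ 2 - 4 * n) / (f : ℤ) ^ 2) : ℂ) * localDensity M 1 t f n := by
    refine Finset.sum_congr rfl fun t ht ↦ ?_
    rw [archFactor_two (Finset.mem_filter.1 ht).2, one_mul]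
  have hC : (∑ t ∈ (Finset.Icc (-(2 * n : ℤ)) (2 * n)).filter (fun t : ℤ => t ^ 2 < 4 * (n : ℤ)),
      ∑ f ∈ ellipticConductors t n,
        (weightedClassNumber ((t ^ 2 - 4 * n) / (f : ℤ) ^ 2) : ℂ) *
          (localDensity M 1 t f n * (localDensity p 1 t f n - 2))) =
      (∑ t ∈ (Finset.Icc (-(2 * n : ℤ)) (2 * n)).filter (fun t : ℤ => t ^ 2 < 4 * (n : ℤ)),
        ∑ f ∈ ellipticConductors t n,
          (weightedClassNumber ((t ^ 2 - 4 * n) / (f : ℤ) ^ 2) : ℂ) * localDensity M 1 t f n *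
            localDensity p 1 t f n) -
      2 * ∑ t ∈ (Finset.Icc (-(2 * n : ℤ)) (2 * n)).filter (fun t : ℤ => t ^ 2 < 4 * (n : ℤ)),
        ∑ f ∈ ellipticConductors t n,
          (weightedClassNumber ((t ^ 2 - 4 * n) / (f : ℤ) ^ 2) : ℂ) * localDensity M 1 t f n := by
    rw [Finset.mul_sum, ← Finset.sum_sub_distrib]
    refine Finset.sum_congr rfl fun t _ ↦ ?_
    rw [Finset.mul_sum, ← Finset.sum_sub_distrib]
    refine Finset.sum_congr rfl fun f _ ↦ ?_
    ring
  rw [hA, hB, hC]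
  push_cast
  split_ifs <;> ring

/-- **The trace of `T_n` on the `p`-new part of `S₂(Γ₀(Mp))`, from the Eichler–Selberg trace
formula at the levels `Mp` and `M`** (`p` prime, `p ∤ M`, `(n, Mp) = 1`):
`Tr(T_n | S₂(Γ₀(Mp))) - 2 Tr(T_n | S₂(Γ₀(M))) = δ(n = □)(p - 1)ψ(M)/12 - σ₁(n)
   - ½ Σ_{t² < 4n} Σ_f h_w((t² - 4n)/f²) μ_M(t, f, n) (μ_p(t, f, n) - 2)`.
This is the left-hand side of Eichler's trace identity with the Brandt matrices of level `M` in
the definite quaternion algebra of discriminant `p` (Eichler 1955 (5); Pizer 1980 Thm. 2.25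
(2.8): `tr_{pM} T(n) - 2 tr_M T(n) = tr B(n; p, M) - σ₁(n)`), conditionally on the tree's named
fact `HeckeTraceFormulaGL2Level N 𝟙 2` at `N = Mp` and `N = M`.
[cite: SchoofVandervlugt1991, Thm. 2.2, p. 168] -/
theorem cuspidalHeckeTrace_mul_prime_sub_of_traceFormula {M p : ℕ} [NeZero M] [NeZero (M * p)]
    (hp : p.Prime) (hpM : ¬ p ∣ M) (hTF₁ : HeckeTraceFormulaGL2Level (M * p) 1 2)
    (hTF₂ : HeckeTraceFormulaGL2Level M 1 2) {n : ℕ} (hn0 : 0 < n) (hn : n.Coprime (M * p)) :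
    cuspidalHeckeTrace (M * p) 2 1 n - 2 * cuspidalHeckeTrace M 2 1 n =
      (if IsSquare n then ((p : ℂ) - 1) * (dedekindPsi M : ℂ) / 12 else 0) - ((σ 1 n : ℕ) : ℂ) -
        (1 / 2 : ℂ) *
          ∑ t ∈ (Finset.Icc (-(2 * n : ℤ)) (2 * n)).filter (fun t : ℤ => t ^ 2 < 4 * (n : ℤ)),
            ∑ f ∈ ellipticConductors t n,
              (weightedClassNumber ((t ^ 2 - 4 * n) / (f : ℤ) ^ 2) : ℂ) *
                (localDensity M 1 t f n * (localDensity p 1 t f n - 2)) := by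
  have hχ : ∀ N : ℕ, (1 : DirichletCharacter ℂ N) (-1) = (-1 : ℂ) ^ (2 : ℤ) := fun N ↦ by
    rw [MulChar.one_apply isUnit_one.neg, zpow_two]
    norm_num
  rw [hTF₁ le_rfl (hχ _) n hn0, hTF₂ le_rfl (hχ _) n hn0]
  exact geometricSide_one_two_mul_prime_sub hp hpM hn

end Literature.NumberTheory.Automorphic.HeckeTraceFormulaGL2Level

end
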